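import Summits.ValiantsHypothesis.ValiantsHypothesis.Theorems.KPlusLogSqLawTridiagonalRealStaticLadderRung

/-!
# Route «KPlusLogSqLaw», crux `WeakLifting` (stmt-ValiantsHypothesis-19561) — REAL side of the tridiagonal sector:
# the PUMP STEP — one hierarchical edge of lift-p3 g9's pump-and-harvest, as a sign-only invariant transfer (orientation by reflection)

HONEST FRAMING.  Helper (`--supports stmt-ValiantsHypothesis-19561 --as helper`), seat val-sym-lift-p1 (g12), cell `pub-symmetroid`,
2026-08-27.  Pure real analysis on top of `…LadderMoves` / `…LadderRung` (split at a first zero, fresh points, sign bookkeeping).  The located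
PUMP of val-sym-lift-p3 g9 (memo HIERARCHICAL-LIMIT-GAME-liftp3g9.md §3/§3c: in the hierarchical limit game the play «cut inside the head pair,
then inside the tail pair, alternately; harvest once» reaches `2m − 6`) is, started from `(D₀, D₁)`, PERIODIC with no middle cluster (this seat's
sign-forced replay, tools/wordgame.py): for odd sizes the interleaving word of the zeros of the two top continuants `(f, g) = (D_{m−1}, D_m)` is
`q p^A q^B p` (`q` = zeros of `g`), for even sizes its mirror image.  This file turns ONE pump move into a theorem WITHOUT locating zeros, via the
SIGN-ONLY PUMP INVARIANT (written out as 17 clauses, no definition): sample points `P0 < x < x₁ < R… < M < T… < y < y₁ < P1`, signs `s, μ = ±1`;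
`g` has sign `s` at `P0`, `−s` at `x, x₁, R, M`, alternates along `M :: T ++ [y]`, has sign `−μ` at `y, y₁, P1` and NO ZERO on `[y, P1]`;
`f` has sign `−s` at `P0, x, x₁` and NO ZERO on `[P0, x₁]`, alternates along `x₁ :: R ++ [M]`, has sign `μ` at `M, T, y, y₁` and `−μ` at `P1`.
`pump_step`: if `h` is continuous, has the sign of `g` at `P0, x` and of `−f` at all other sample points (one hierarchical edge switching
between `x` and `x₁`), and at every zero of `h` in `[P0, x]` one has `A·g = B·f` with `A, B > 0` (true for `h = x^e g − b² x^{2f'} f`), then the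
pair `(g, h)` satisfies the MIRROR-IMAGE invariant — stated as the same 17 clauses for the reflected functions `z ↦ g(−z)`, `z ↦ h(−z)` on the
negated, reversed sample list, with two new points `w₁ < w` separating the zero of `g` in `(P0, x)` from its displaced copy in `h` (first zero
of `h` by `exists_split_first`; at a zero of `h` the sign of `g` equals the sign of `f`, which clause C4 certifies).  Net effect per move: the
certified alternations of the newest continuant grow from `|T| + 2` to `|R| + 4` while `(|R|, |T|) ↦ (|T|, |R| + 2)` — two more letters per
edge, harvested in the companion file.  Nothing here is an upper bound; nothing bears on `WeakLifting` / `TropicalB` in their windows, Conjecture B,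
the doors, `MatrixDescartes` (stmt-18050) or VP ≠ VNP.  [mechanism: val-sym-lift-p3 g9's pump; folklore analysis]
-/

-- `Summit.ValiantsHypothesis.ValiantsHypothesis.…` repeats a component by the D-0017 layout (single-conjunct summit); the name is mandated.
set_option linter.dupNamespace false
set_option autoImplicit false

namespace Summit.ValiantsHypothesis.ValiantsHypothesis.Theorems.KPlusLogSqLaw.StaticTridiagonalRealLadder

open Set

/-! ### Reflection of sample lists -/

/-- a strictly increasing list, reversed and negated, is strictly increasing. [folklore] -/
theorem isChain_lt_reverse_neg {L : List ℝ} (h : L.IsChain (· < ·)) :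
    (L.reverse.map (fun z : ℝ => -z)).IsChain (· < ·) := by
  rw [List.isChain_map, List.isChain_reverse]
  exact List.IsChain.imp (fun a b (hab : a < b) => neg_lt_neg hab) h

/-- an alternation list of `φ`, reversed and negated, is an alternation list of `z ↦ φ (−z)`. [folklore] -/
theorem isChain_alt_reverse_neg (φ : ℝ → ℝ) {L : List ℝ} (h : L.IsChain (fun a b => φ a * φ b < 0)) :
    (L.reverse.map (fun z : ℝ => -z)).IsChain (fun a b => (fun z => φ (-z)) a * (fun z => φ (-z)) b < 0) := by
  rw [List.isChain_map, List.isChain_reverse]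
  refine List.IsChain.imp (fun a b (hab : φ a * φ b < 0) => ?_) h
  simp only [neg_neg]
  rwa [mul_comm]

/-- membership in a reversed negated list. [folklore] -/
theorem mem_reverse_neg {L : List ℝ} {r : ℝ} (hr : r ∈ L.reverse.map (fun z : ℝ => -z)) : -r ∈ L := by
  rw [List.mem_map] at hr
  obtain ⟨t, ht, rfl⟩ := hr
  rw [List.mem_reverse] at ht
  simpa using ht

/-- the reflected sample list of the pump step is the negated reverse of the refined old list. [folklore: list algebra] -/
theorem reflect_full (P0 w₁ w x x₁ M y y₁ P1 : ℝ) (R T : List ℝ) :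
    ((-P1) :: (-y₁) :: (-y) :: ((T.reverse.map (fun z : ℝ => -z)) ++ (-M) ::
      (((x :: x₁ :: R).reverse.map (fun z : ℝ => -z)) ++ [-w, -w₁, -P0]))) =
    ((P0 :: w₁ :: w :: x :: x₁ :: (R ++ M :: (T ++ [y, y₁, P1]))).reverse.map (fun z : ℝ => -z)) := by
  simp [List.reverse_append, List.map_append, List.map_reverse]

/-- the reflected alternation list at the far end. [folklore: list algebra] -/
theorem reflect_far (w x x₁ M : ℝ) (R : List ℝ) :
    ((-M) :: (((x :: x₁ :: R).reverse.map (fun z : ℝ => -z)) ++ [-w])) =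
    ((w :: x :: x₁ :: (R ++ [M])).reverse.map (fun z : ℝ => -z)) := by
  simp [List.reverse_append, List.map_append, List.map_reverse]

/-- the reflected alternation list at the near end. [folklore: list algebra] -/
theorem reflect_near (y M : ℝ) (T : List ℝ) :
    ((-y) :: ((T.reverse.map (fun z : ℝ => -z)) ++ [-M])) = ((M :: (T ++ [y])).reverse.map (fun z : ℝ => -z)) := by
  simp [List.reverse_append, List.map_append, List.map_reverse]

/-! ### The pump step -/

/-- **THE PUMP STEP** (module docstring): one hierarchical edge maps the sign-only pump invariant of `(f, g; s, μ)` on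
`P0 < x < x₁ < R < M < T < y < y₁ < P1` to the same invariant for the REFLECTED pair `(z ↦ g(−z), z ↦ h(−z); μ, −s)` on the negated
reversed list refined by two new points `w₁ < w` in `(P0, x)`. [mechanism: lift-p3 g9's pump; folklore analysis] -/
theorem pump_step {f g h : ℝ → ℝ} (hg : Continuous g) (hh : Continuous h) {s μ : ℝ} {P0 x x₁ M y y₁ P1 : ℝ}
    {R T : List ℝ}
    (c1 : (P0 :: x :: x₁ :: (R ++ M :: (T ++ [y, y₁, P1]))).IsChain (· < ·))
    (c2a : 0 < s * g P0)
    (c2b : s * g x < 0)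
    (c2c : s * g x₁ < 0)
    (c2d : (∀ r ∈ R, s * g r < 0))
    (c2e : s * g M < 0)
    (c2f : (M :: (T ++ [y])).IsChain (fun a b => g a * g b < 0))
    (c2g : μ * g y < 0)
    (c3c : s * f x₁ < 0)
    (c3d : (x₁ :: (R ++ [M])).IsChain (fun a b => f a * f b < 0))
    (c3e : 0 < μ * f M)
    (c3f : (∀ t ∈ T, 0 < μ * f t))
    (c3g : 0 < μ * f y)
    (c3h : 0 < μ * f y₁)
    (c3i : μ * f P1 < 0)
    (c4 : (∀ z ∈ Set.Icc P0 x₁, s * f z < 0))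
    (c5 : (∀ z ∈ Set.Icc y P1, μ * g z < 0))
    (m1 : 0 < h P0 * g P0) (m1' : 0 < h x * g x)
    (m2 : ∀ P ∈ x₁ :: (R ++ M :: (T ++ [y, y₁, P1])), 0 < -(h P * f P))
    (m3 : ∀ z ∈ Set.Icc P0 x, h z = 0 → ∃ A B : ℝ, 0 < A ∧ 0 < B ∧ A * g z = B * f z) :
    ∃ w₁ w : ℝ,
      (((-P1) :: (-y₁) :: (-y) :: (((T).reverse.map (fun z : ℝ => -z)) ++ (-M) :: (((x :: x₁ :: R).reverse.map (fun z : ℝ => -z)) ++ [(-w), (-w₁), (-P0)]))).IsChain (· < ·) ∧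
        0 < μ * (fun z => h (-z)) (-P1) ∧
        μ * (fun z => h (-z)) (-y₁) < 0 ∧
        μ * (fun z => h (-z)) (-y) < 0 ∧
        (∀ r ∈ ((T).reverse.map (fun z : ℝ => -z)), μ * (fun z => h (-z)) r < 0) ∧
        μ * (fun z => h (-z)) (-M) < 0 ∧
        ((-M) :: (((x :: x₁ :: R).reverse.map (fun z : ℝ => -z)) ++ [(-w)])).IsChain (fun a b => (fun z => h (-z)) a * (fun z => h (-z)) b < 0) ∧
        (-s) * (fun z => h (-z)) (-w) < 0 ∧
        μ * (fun z => g (-z)) (-y) < 0 ∧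
        ((-y) :: (((T).reverse.map (fun z : ℝ => -z)) ++ [(-M)])).IsChain (fun a b => (fun z => g (-z)) a * (fun z => g (-z)) b < 0) ∧
        0 < (-s) * (fun z => g (-z)) (-M) ∧
        (∀ t ∈ ((x :: x₁ :: R).reverse.map (fun z : ℝ => -z)), 0 < (-s) * (fun z => g (-z)) t) ∧
        0 < (-s) * (fun z => g (-z)) (-w) ∧
        0 < (-s) * (fun z => g (-z)) (-w₁) ∧
        (-s) * (fun z => g (-z)) (-P0) < 0 ∧
        (∀ z ∈ Set.Icc (-P1) (-y), μ * (fun z => g (-z)) z < 0) ∧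
        (∀ z ∈ Set.Icc (-w) (-P0), (-s) * (fun z => h (-z)) z < 0)) := by
  -- orderings from the strictly increasing list
  have o1 : P0 < x := (List.isChain_cons_cons.mp c1).1
  have c1' := (List.isChain_cons_cons.mp c1).2
  have o2 : x < x₁ := (List.isChain_cons_cons.mp c1').1
  have ctail : (x₁ :: (R ++ M :: (T ++ [y, y₁, P1]))).IsChain (· < ·) := (List.isChain_cons_cons.mp c1').2
  -- signs of `h` at the sample points
  have hP0 : 0 < s * h P0 := sgn_of_mul_pos m1 c2a
  have hx : s * h x < 0 := by
    have := sgn_of_mul_pos m1' (show 0 < (-s) * g x by linarith); linarith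
  have hf_of : ∀ P ∈ x₁ :: (R ++ M :: (T ++ [y, y₁, P1])), ∀ τ : ℝ, 0 < τ * f P → τ * h P < 0 :=
    fun P hP τ hτ => sgn_of_mul_neg (m2 P hP) hτ
  have memx₁ : x₁ ∈ x₁ :: (R ++ M :: (T ++ [y, y₁, P1])) := by simp
  have memR : ∀ r ∈ R, r ∈ x₁ :: (R ++ M :: (T ++ [y, y₁, P1])) := fun r hr => by simp [hr]
  have memM : M ∈ x₁ :: (R ++ M :: (T ++ [y, y₁, P1])) := by simp
  have memT : ∀ t ∈ T, t ∈ x₁ :: (R ++ M :: (T ++ [y, y₁, P1])) := fun t ht => by simp [ht]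
  have memy : y ∈ x₁ :: (R ++ M :: (T ++ [y, y₁, P1])) := by simp
  have memy₁ : y₁ ∈ x₁ :: (R ++ M :: (T ++ [y, y₁, P1])) := by simp
  have memP1 : P1 ∈ x₁ :: (R ++ M :: (T ++ [y, y₁, P1])) := by simp
  have hx₁ : 0 < s * h x₁ := by
    have := hf_of x₁ memx₁ (-s) (by linarith); linarith
  have hM : μ * h M < 0 := hf_of M memM μ c3e
  have hT : ∀ t ∈ T, μ * h t < 0 := fun t ht => hf_of t (memT t ht) μ (c3f t ht)
  have hy : μ * h y < 0 := hf_of y memy μ c3g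
  have hy₁ : μ * h y₁ < 0 := hf_of y₁ memy₁ μ c3h
  have hP1 : 0 < μ * h P1 := by
    have := hf_of P1 memP1 (-μ) (by linarith); linarith
  -- SPLIT at the first zero of `h` in `[P0, x]`: at such a zero, `sign g = sign f = −s`
  obtain ⟨w, ⟨hP0w, hwx⟩, hw_nv, hgw⟩ := exists_split_first hh hg (s := s) (u := -s) o1 hP0 hx
    (by
      intro z hz hz0
      obtain ⟨A, B, hA, hB, hAB⟩ := m3 z hz hz0
      have hfz : s * f z < 0 := c4 z ⟨hz.1, hz.2.trans o2.le⟩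
      have h1 : s * (A * g z) < 0 := by rw [hAB]; nlinarith
      have h2 : A * (s * g z) < 0 := by linarith [show s * (A * g z) = A * (s * g z) by ring]
      have h3 : s * g z < 0 := by
        by_contra hcon; push Not at hcon; nlinarith
      linarith)
  -- a fresh point `w₁ ∈ (P0, w)` where `g` keeps the sign `−s`
  obtain ⟨w₁, ⟨hP0w₁, hw₁w⟩, hgw₁⟩ := exists_point_left hg (s := -s) hP0w hgw
  have hhw : 0 < s * h w := hw_nv w ⟨hP0w.le, le_rfl⟩
  have hhw₁ : 0 < s * h w₁ := hw_nv w₁ ⟨hP0w₁.le, hw₁w.le⟩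
  refine ⟨w₁, w, ?_, ?_, ?_, ?_, ?_, ?_, ?_, ?_, ?_, ?_, ?_, ?_, ?_, ?_, ?_, ?_, ?_⟩
  · -- C1: the reflected list is strictly increasing
    rw [reflect_full]
    apply isChain_lt_reverse_neg
    simp only [List.isChain_cons_cons]
    exact ⟨hP0w₁, hw₁w, hwx, o2, ctail⟩
  · show 0 < μ * h (- -P1); rw [neg_neg]; exact hP1
  · show μ * h (- -y₁) < 0; rw [neg_neg]; exact hy₁
  · show μ * h (- -y) < 0; rw [neg_neg]; exact hy
  · intro r hr
    show μ * h (-r) < 0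
    exact hT (-r) (mem_reverse_neg hr)
  · show μ * h (- -M) < 0; rw [neg_neg]; exact hM
  · -- alternation of `h` from `M` down to `w` (reflected)
    rw [reflect_far]
    apply isChain_alt_reverse_neg
    show (w :: x :: x₁ :: (R ++ [M])).IsChain (fun a b => h a * h b < 0)
    simp only [List.isChain_cons_cons]
    refine ⟨mul_neg_of_sgn hhw hx, mul_neg_of_sgn (t := -s) (by linarith) (by linarith), ?_⟩
    refine (isChain_alt_congr (c := -1) (f := f) (g := h) ?_).mp c3d
    intro P hP
    have hP' : P ∈ x₁ :: (R ++ M :: (T ++ [y, y₁, P1])) := by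
      simp only [List.mem_cons, List.mem_append] at hP ⊢
      tauto
    have := m2 P hP'
    linarith
  · show (-s) * h (- -w) < 0; rw [neg_neg]; linarith
  · show μ * g (- -y) < 0; rw [neg_neg]; exact c2g
  · rw [reflect_near]
    exact isChain_alt_reverse_neg g c2f
  · show 0 < (-s) * g (- -M); rw [neg_neg]; linarith [c2e]
  · intro t ht
    show 0 < (-s) * g (-t)
    have hmem : -t ∈ x :: x₁ :: R := mem_reverse_neg ht
    simp only [List.mem_cons] at hmem
    rcases hmem with h1 | h1 | h1
    · rw [h1]; linarith [c2b]
    · rw [h1]; linarith [c2c]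
    · linarith [c2d (-t) h1]
  · show 0 < (-s) * g (- -w); rw [neg_neg]; exact hgw
  · show 0 < (-s) * g (- -w₁); rw [neg_neg]; exact hgw₁
  · show (-s) * g (- -P0) < 0; rw [neg_neg]; linarith [c2a]
  · intro z hz
    show μ * g (-z) < 0
    exact c5 (-z) ⟨by linarith [hz.2], by linarith [hz.1]⟩
  · intro z hz
    show (-s) * h (-z) < 0
    have := hw_nv (-z) ⟨by linarith [hz.2], by linarith [hz.1]⟩
    linarith

end Summit.ValiantsHypothesis.ValiantsHypothesis.Theorems.KPlusLogSqLaw.StaticTridiagonalRealLadder
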